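import Summits.HodgeConjecture.CorCM.CMProductFivefoldsOfMarkman
import Summits.HodgeConjecture.CorCM.CMFourfoldsOfMarkman
import Literature.AlgebraicGeometry.ComplexMultiplication.SimpleIffPrimitiveCMType
import Literature.AlgebraicGeometry.Motives.AbelianVarietySimpleOfIsogeny
import Literature.AlgebraicGeometry.Milne1999.CMSimpleIsogenousCMTyped
import HarnessLib

/-!
# The Hodge conjecture for complex abelian varieties of CM type of dimension `≤ 5`, from Markman's theorem

Cell `pub-hodgecm2` (COR-CM), count-neutral sub-row A3-CM45-products, file 6 (capstone).  HONEST FRAMING: a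
CONDITIONAL result — `HC_CM` restricted to dimension `≤ 5`, conditional ONLY on the named fact
`HodgeTheory.Markman2025_weilClasses_algebraic_abelianFourfold` (Markman 2025, B2b floor R1); `HC_CM` itself is never
asserted.  This is the CM slice of the named fact `Markman2025_hodgeClasses_algebraic_abelian_dim_le_five` (R2), with
the Moonen–Zarhin inputs `MoonenZarhin1999_codimTwoHodgeClasses_abelianFourfold/…Fivefold` of its printed proof
REPLACED, for CM abelian varieties, by Pohlmann's theorem for CM algebras and the elementary dichotomies
«divisor pairs or Weil section» (`CMWeilSectionDichotomy`, `CMWeilSectionFivefold`).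

The pair-rigidity hypothesis of `hodgeConjectureFor_biproduct_dim_five_of_markman` — inside one block `Hom(K_i, ℂ)` the
only Galois-balanced pairs are the conjugate pairs `{s, s̄}` — holds as soon as every factor `A_i` is SIMPLE: a
balanced pair `{s, t}` makes `t` and `s̄` have the same pattern `τ ↦ [τ ∘ · ∈ Φ_i]`, and by Shimura's Prop. 26
(`isSimple_iff_primitive`, simple ⟺ primitive) such embeddings coincide (§1).  Every CM abelian variety is
isogenous to a product of SIMPLE CM-typed abelian varieties (§2: the hereditary Poincaré decomposition
`exists_isogeny_from_productOf_simple_pos_of_hereditary`, Deligne's `exists_isCMTyped_isIsogenous_of_isSimple`, and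
isogeny invariance of simplicity `isSimple_iff_of_isIsogenous`), and such a product is dominated by a biproduct of
simple realisations of the same dimension; the Hodge conjecture then transfers along the domination and the isogeny
exactly as in dimension `4` (§3).

* `eq_conj_smul_of_isGaloisBalancedAlg_pair_of_isSimple` — pair rigidity for families of simple realisations;
* `exists_isProductOf_of_atoms`, `exists_isProductOf_simple_cmTyped`, `exists_simple_biproduct_family_of_isProductOf`;
* **`hodgeConjectureFor_of_isOfCMType_dim_five_of_markman`** — `A` of CM type, `dim A = 5` ⟹
  `HodgeConjectureFor A.dim A.X`, granted Markman's fact;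
* **`cmHodgeHypothesisAt_of_dim_le_five_of_markman`** — `Milne1999.CMHodgeHypothesisAt A` for every complex abelian
  variety of dimension `≤ 5`, granted Markman's fact (`hodgeConjectureFor_of_isOfCMType_dim_le_five_of_markman`: the
  same as `IsOfCMType A → dim A ≤ 5 → HodgeConjectureFor A.dim A.X`).

## References

* [MoonenZarhin1999LowDim] B. Moonen, Yu. Zarhin, Math. Ann. 315 (1999) 711–733, Thms. 0.1, 0.2.
* [Markman2025SurveySecant] E. Markman, arXiv:2509.23403, Thm. 1.2, §1.1 and Cor. 1.3.
* [Shimura1998] G. Shimura, *Abelian Varieties with Complex Multiplication and Modular Functions*, §8.2 Prop. 26,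
  §5.1 Props. 3–6, §7.1.
* [MumfordAV1970] D. Mumford, *Abelian Varieties*, §19 Thm. 1 and Cor. 1.
* [Deligne1982HodgeCycles] P. Deligne, *Hodge cycles on abelian varieties*, LNM 900, I Prop. 5.1.
-/

noncomputable section

open CategoryTheory CategoryTheory.Limits NumberField

namespace Summit.HodgeConjecture.CorCM.CMWeights

open Literature.AlgebraicGeometry.Motives Literature.AlgebraicGeometry.Motives.AbelianVariety
open Literature.AlgebraicGeometry.HodgeTheory
open Literature.AlgebraicGeometry.Pohlmann1968
open Literature.AlgebraicGeometry.ComplexMultiplication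
open Literature.AlgebraicGeometry.Milne1999
open Literature.NumberTheory.ComplexMultiplication
open Summit.HodgeConjecture.CorCM.Domination Summit.HodgeConjecture.CorCM.AndreRiemann
open _root_.AlgebraicGeometry (IsClosedImmersion)

open scoped Classical Pointwise

/-! ### §1 Pair rigidity for simple realisations (Shimura's Prop. 26) -/

section Rigid

variable {n : ℕ} {K : Fin n → Type} [∀ i, Field (K i)] [∀ i, NumberField (K i)] [∀ i, IsCMField (K i)]
variable {A : Fin n → AbelianVariety ℂ} {Φ : ∀ i, CMType (K i)} {ι : ∀ i, 𝓞 (K i) →+* End (A i)}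
  {θ : ∀ i, K i →+* Module.End ℂ (complexBetti (A i).X 1)}

omit [∀ i, NumberField (K i)] [∀ i, IsCMField (K i)] in
/-- **A balanced pair is a complementary pair**: if `{x, y}` (`x ≠ y`) satisfies Pohlmann's Galois condition then,
for every `τ ∈ Aut(ℂ)`, exactly one of `τ ∘ x`, `τ ∘ y` lies in the type. [cite: GaoUllmo2025, Thm. 3.1 (3.2)] -/
theorem comp_mem_iff_comp_not_mem_of_isGaloisBalancedAlg_pair (Φ : ∀ i, CMType (K i))
    {x y : (i : Fin n) × (K i →+* ℂ)} (hxy : x ≠ y) (hbal : IsGaloisBalancedAlg Φ ({x} ∪ ({y} : Finset _)))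
    (τ : ℂ ≃+* ℂ) : (τ : ℂ →+* ℂ).comp x.2 ∈ (Φ x.1).1 ↔ (τ : ℂ →+* ℂ).comp y.2 ∉ (Φ y.1).1 := by
  have h := hbal τ
  have hdisj : Disjoint ({x} : Finset ((i : Fin n) × (K i →+* ℂ))) {y} := Finset.disjoint_singleton.2 hxy
  rw [ncard_sep_union_of_disjoint hdisj (fun z => (τ : ℂ →+* ℂ).comp z.2 ∈ (Φ z.1).1),
    ncard_sep_union_of_disjoint hdisj (fun z => (τ : ℂ →+* ℂ).comp z.2 ∉ (Φ z.1).1),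
    ncard_sep_singleton_mem, ncard_sep_singleton_mem, ncard_sep_singleton_not_mem,
    ncard_sep_singleton_not_mem] at h
  by_cases hx : (τ : ℂ →+* ℂ).comp x.2 ∈ (Φ x.1).1 <;> by_cases hy : (τ : ℂ →+* ℂ).comp y.2 ∈ (Φ y.1).1
  · rw [if_pos hx, if_pos hy, if_pos hx, if_pos hy] at h; omega
  · exact ⟨fun _ => hy, fun _ => hx⟩
  · exact ⟨fun h' => (hx h').elim, fun h' => (h' hy).elim⟩
  · rw [if_neg hx, if_neg hy, if_neg hx, if_neg hy] at h; omega

/-- **Pair rigidity for families of SIMPLE realisations.**  If every `A_i` is a simple realisation of `(K_i; Φ_i)`,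
then the only Galois-balanced pairs inside one block `Hom(K_i, ℂ)` are the conjugate pairs `{s, s̄}`: a balanced
pair `{s, t}` forces `τ ∘ s̄ ∈ Φ_i ⟺ τ ∘ s ∉ Φ_i ⟺ τ ∘ t ∈ Φ_i` for all `τ ∈ Aut(ℂ)` (`Φ_i` is a CM type and complex
conjugation commutes with `Aut(ℂ)` on a CM field), and Shimura's Proposition 26 («simple ⟺ primitive»,
`isSimple_iff_primitive`) gives `t = s̄`. [cite: Shimura1998, §8.2 Prop. 26 (p. 63)] -/
theorem eq_conj_smul_of_isGaloisBalancedAlg_pair_of_isSimple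
    (hA : ∀ i, IsCMTypeRealisation (Φ i) (A i) (ι i) (θ i)) (hs : ∀ i, (A i).IsSimple) :
    ∀ x y : (i : Fin n) × (K i →+* ℂ), x.1 = y.1 → x ≠ y →
      IsGaloisBalancedAlg Φ ({x} ∪ ({y} : Finset _)) → y = (starRingAut : ℂ ≃+* ℂ) • x := by
  rintro ⟨i, s⟩ ⟨j, t⟩ hij hxy hbal
  dsimp only at hij
  subst hij
  have hone := comp_mem_iff_comp_not_mem_of_isGaloisBalancedAlg_pair Φ hxy hbal
  -- `s̄` and `t` have the same pattern
  have hpat : ∀ τ : ℂ ≃+* ℂ,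
      (τ : ℂ →+* ℂ).comp (((starRingAut : ℂ ≃+* ℂ) : ℂ →+* ℂ).comp s) ∈ (Φ i).1 ↔
        (τ : ℂ →+* ℂ).comp t ∈ (Φ i).1 := by
    intro τ
    have hcomm := smul_conj_smul_comm τ (⟨i, s⟩ : (i : Fin n) × (K i →+* ℂ))
    have hmem := conj_smul_mem_iff Φ (τ • (⟨i, s⟩ : (i : Fin n) × (K i →+* ℂ)))
    rw [← hcomm] at hmem
    exact hmem.trans (hone τ).not_left
  have hst := (isSimple_iff_primitive (hA i)).1 (hs i) _ _ hpat
  rw [smul_sigma_eq, hst]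

end Rigid

/-! ### §2 CM abelian varieties are isogenous to biproducts of SIMPLE realisations -/

/-- Transport of atoms along isogenies through a product tree (the tree's `exists_isProductOf_isCMTyped_of_atoms`
with an arbitrary target predicate). [folklore] -/
theorem exists_isProductOf_of_atoms {R R' : AbelianVariety ℂ → Prop}
    (hR : ∀ B : AbelianVariety ℂ, R B → ∃ B' : AbelianVariety ℂ, R' B' ∧ IsIsogenous B B')
    {P : AbelianVariety ℂ} (hP : IsProductOf R P) :
    ∃ P' : AbelianVariety ℂ, IsProductOf R' P' ∧ IsIsogenous P P' := by
  induction hP with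
  | atom h =>
    obtain ⟨B', hB', hiso⟩ := hR _ h
    exact ⟨B', .atom hB', hiso⟩
  | prod _ _ ih₁ ih₂ =>
    obtain ⟨P₁, h₁, i₁⟩ := ih₁
    obtain ⟨P₂, h₂, i₂⟩ := ih₂
    exact ⟨P₁.prod P₂, .prod h₁ h₂, i₁.prod i₂⟩

/-- **Every complex abelian variety of CM type of positive dimension is isogenous to a finite product of SIMPLE
CM-typed abelian varieties**: the hereditary Poincaré decomposition into simple abelian subvarieties of positive
dimension (`exists_isogeny_from_productOf_simple_pos_of_hereditary`), CM type at simple subvarieties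
(`isOfCMType_of_isSimple_of_isClosedImmersion`), Deligne's «simple of CM type ⟹ isogenous to a CM-typed one»
(`exists_isCMTyped_isIsogenous_of_isSimple`, unconditional), and isogeny invariance of simplicity
(`isSimple_iff_of_isIsogenous`). [cite: MumfordAV1970, §19 Thm. 1 Cor. 1 (pp. 173–174)]
[cite: Deligne1982HodgeCycles, I Prop. 5.1 and §5 (p. 37)] [cite: Shimura1998, §5.1 Props. 3–6, §7.1 Prop. 7] -/
theorem exists_isProductOf_simple_cmTyped (A : AbelianVariety ℂ) (hA0 : 0 < A.dim) (hA : IsOfCMType A) :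
    ∃ B : AbelianVariety ℂ, IsProductOf (fun B => IsCMTyped B ∧ B.IsSimple) B ∧ IsIsogenous A B := by
  obtain ⟨P, g, hP, hg⟩ :=
    exists_isogeny_from_productOf_simple_pos_of_hereditary
      (fun B ↦ ∃ f : B ⟶ A, IsClosedImmersion (AbelianVariety.Hom.toSchemeHom f))
      (fun B C f hf ⟨i, hi⟩ ↦ ⟨f ≫ i, by
        haveI := hf; haveI := hi
        change IsClosedImmersion (AbelianVariety.Hom.toSchemeHom f ≫ AbelianVariety.Hom.toSchemeHom i)
        infer_instance⟩)
      A ⟨𝟙 A, by change IsClosedImmersion (𝟙 A.X.left); infer_instance⟩ hA0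
  obtain ⟨P', hP', hPP'⟩ := exists_isProductOf_of_atoms (R' := fun B => IsCMTyped B ∧ B.IsSimple)
    (fun B ⟨hsB, hB0, i, hi⟩ ↦ by
      haveI := hi
      obtain ⟨B', hB', hBB'⟩ :=
        exists_isCMTyped_isIsogenous_of_isSimple B hsB hB0 (isOfCMType_of_isSimple_of_isClosedImmersion hA hsB i)
      exact ⟨B', ⟨hB', (isSimple_iff_of_isIsogenous hBB').1 hsB⟩, hBB'⟩) hP
  exact ⟨P', hP', (IsIsogenous.symm_of_charZero (A := P) (B := A) ⟨g, hg⟩).trans hPP'⟩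

/-- **A finite product of SIMPLE CM-typed abelian varieties is dominated by a biproduct of SIMPLE realisations of the
same total dimension** (the proof of `exists_biproduct_family_of_isProductOf`, carrying simplicity along).
[cite: MumfordAV1970, §19 Thm. 1 and p. 169] -/
theorem exists_simple_biproduct_family_of_isProductOf {B : AbelianVariety ℂ}
    (hB : IsProductOf (fun B => IsCMTyped B ∧ B.IsSimple) B) :
    ∃ (n : ℕ) (K : Fin n → Type) (_ : ∀ i, Field (K i)) (_ : ∀ i, NumberField (K i)) (_ : ∀ i, IsCMField (K i))
      (C : Fin n → AbelianVariety ℂ) (Φ : ∀ i, CMType (K i)) (ι : ∀ i, 𝓞 (K i) →+* End (C i))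
      (θ : ∀ i, K i →+* Module.End ℂ (complexBetti (C i).X 1)),
      (∀ i, IsCMTypeRealisation (Φ i) (C i) (ι i) (θ i)) ∧ (∀ i, (C i).IsSimple) ∧ AVDominatedBy B (⨁ C) ∧
        (⨁ C).dim = B.dim := by
  classical
  induction hB with
  | @atom B hBt =>
    obtain ⟨hBt, hsB⟩ := hBt
    obtain ⟨Φ, B, ι, θ, h⟩ := hBt
    rename_i K _ _ _
    refine ⟨1, fun _ => K, fun _ => inferInstance, fun _ => inferInstance, fun _ => inferInstance, fun _ => B,
      fun _ => Φ, fun _ => ι, fun _ => θ, fun _ => h, fun _ => hsB, avDominatedBy_biproduct_single B, ?_⟩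
    rw [dim_biproduct_fin]
    simp
  | @prod B₁ B₂ _ _ ih₁ ih₂ =>
    obtain ⟨n₁, K₁, iF₁, iN₁, iC₁, C₁, Φ₁, ι₁, θ₁, hC₁, hs₁, hd₁, hdim₁⟩ := ih₁
    obtain ⟨n₂, K₂, iF₂, iN₂, iC₂, C₂, Φ₂, ι₂, θ₂, hC₂, hs₂, hd₂, hdim₂⟩ := ih₂
    let K : Fin n₁ ⊕ Fin n₂ → Type := fun j => match j with | Sum.inl j => K₁ j | Sum.inr j => K₂ j
    letI iF : ∀ j, Field (K j) := fun j => match j with | Sum.inl j => iF₁ j | Sum.inr j => iF₂ j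
    letI iN : ∀ j, NumberField (K j) := fun j => match j with | Sum.inl j => iN₁ j | Sum.inr j => iN₂ j
    have iC : ∀ j, IsCMField (K j) := fun j => match j with | Sum.inl j => iC₁ j | Sum.inr j => iC₂ j
    let Φ : ∀ j, CMType (K j) := fun j => match j with | Sum.inl j => Φ₁ j | Sum.inr j => Φ₂ j
    let ι : ∀ j, 𝓞 (K j) →+* End (sumFam C₁ C₂ j) := fun j => match j with | Sum.inl j => ι₁ j | Sum.inr j => ι₂ j
    let θ : ∀ j, K j →+* Module.End ℂ (complexBetti (sumFam C₁ C₂ j).X 1) :=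
      fun j => match j with | Sum.inl j => θ₁ j | Sum.inr j => θ₂ j
    have hC : ∀ j, IsCMTypeRealisation (Φ j) (sumFam C₁ C₂ j) (ι j) (θ j) :=
      fun j => match j with | Sum.inl j => hC₁ j | Sum.inr j => hC₂ j
    have hS : ∀ j, (sumFam C₁ C₂ j).IsSimple := fun j => match j with | Sum.inl j => hs₁ j | Sum.inr j => hs₂ j
    let e : Fin (n₁ + n₂) ≃ Fin n₁ ⊕ Fin n₂ := finSumFinEquiv.symm
    refine ⟨n₁ + n₂, fun i => K (e i), fun i => iF (e i), fun i => iN (e i), fun i => iC (e i),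
      fun i => sumFam C₁ C₂ (e i), fun i => Φ (e i), fun i => ι (e i), fun i => θ (e i), fun i => hC (e i),
      fun i => hS (e i), avDominatedBy_biproduct_reindex e (avDominatedBy_prod_of_biproduct hd₁ hd₂), ?_⟩
    rw [dim_biproduct_fin, dim_prod, ← hdim₁, ← hdim₂, dim_biproduct_fin, dim_biproduct_fin]
    rw [show (∑ i : Fin (n₁ + n₂), (sumFam C₁ C₂ (e i)).dim) = ∑ j : Fin n₁ ⊕ Fin n₂, (sumFam C₁ C₂ j).dim from
      Fintype.sum_equiv e _ _ fun _ => rfl, Fintype.sum_sum_type]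

/-! ### §3 Dimension `5` and dimension `≤ 5` -/

/-- **The Hodge conjecture for every complex abelian variety of CM type of dimension `5`, granted Markman's theorem on
the Weil classes of abelian fourfolds.**  `A` is isogenous to a product of SIMPLE CM-typed abelian varieties
(`exists_isProductOf_simple_cmTyped`), dominated by a biproduct `⨁_i C_i` of simple realisations of total dimension
`5` (`exists_simple_biproduct_family_of_isProductOf`); the family is pair-rigid
(`eq_conj_smul_of_isGaloisBalancedAlg_pair_of_isSimple`), so the biproduct satisfies the Hodge conjecture granted
Markman's fact (`hodgeConjectureFor_biproduct_dim_five_of_markman`); algebraicity descends along the domination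
(`AndreSplit.mem_algebraicClasses_of_avDominatedBy`) and the isogeny (`HodgeConjectureFor.of_isIsogenous`).  The CM
slice, in dimension `5`, of Moonen–Zarhin 1999 Thm. 0.2 + Markman 2025, with the Moonen–Zarhin input re-proved for
CM varieties. [cite: MoonenZarhin1999LowDim, Thm. 0.2] [cite: Markman2025SurveySecant, §1.1 and Cor. 1.3]
[cite: Shimura1998, §8.2 Prop. 26, §5.1 Props. 3–6 and §7.1] [cite: MumfordAV1970, §19 Thm. 1] -/
theorem hodgeConjectureFor_of_isOfCMType_dim_five_of_markman
    (hW4 : Markman2025_weilClasses_algebraic_abelianFourfold) (A : AbelianVariety ℂ) (hCM : IsOfCMType A)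
    (h5 : A.dim = 5) : HodgeConjectureFor A.dim A.X := by
  obtain ⟨B, hB, hAB⟩ := exists_isProductOf_simple_cmTyped A (by omega) hCM
  obtain ⟨n, K, iF, iN, iC, C, Φ, ι, θ, hC, hsC, hdom, hdim⟩ := exists_simple_biproduct_family_of_isProductOf hB
  have hBdim : B.dim = 5 := by
    obtain ⟨g, hg⟩ := hAB
    rw [← dim_eq_of_isIsogeny hg, h5]
  have hCdim : (⨁ C).dim = 5 := hdim.trans hBdim
  have hP : HodgeConjectureFor (⨁ C).dim (⨁ C).X := by
    rw [hCdim]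
    exact hodgeConjectureFor_biproduct_dim_five_of_markman hW4 hC
      (eq_conj_smul_of_isGaloisBalancedAlg_pair_of_isSimple hC hsC) hCdim
  have hBhc : HodgeConjectureFor B.dim B.X :=
    ⟨nonempty_hodgeModel_holds (AbelianVariety.isSmoothProjective_holds (A := B)), fun p c hc hpp =>
      AndreSplit.mem_algebraicClasses_of_avDominatedBy hdom (fun c' hc' hh' => hP.2 p c' hc' hh') c hc hpp⟩
  exact HodgeConjectureFor.of_isIsogenous hAB hBhc

/-- **`HC_CM` in dimension `≤ 5`, granted Markman's theorem**: Milne's hypothesis `CMHodgeHypothesisAt A` (the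
instance at `A` of the cell's E-term `HC_CM = RankFourFaces.CMAbelianHodge`) holds for every complex abelian variety
`A` of dimension `≤ 5`, conditional only on `Markman2025_weilClasses_algebraic_abelianFourfold`: dimension `≤ 4` is
`cmHodgeHypothesisAt_of_dim_le_four_of_markman`, dimension `5` is `hodgeConjectureFor_of_isOfCMType_dim_five_of_markman`.
The CM slice of the fact `Markman2025_hodgeClasses_algebraic_abelian_dim_le_five` (R2) from the fourfold Weil-class
theorem (R1) alone. [cite: MoonenZarhin1999LowDim, Thms. 0.1, 0.2] [cite: Markman2025SurveySecant, §1.1 and Cor. 1.3] -/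
theorem cmHodgeHypothesisAt_of_dim_le_five_of_markman (hW4 : Markman2025_weilClasses_algebraic_abelianFourfold)
    (A : AbelianVariety ℂ) (hA : A.dim ≤ 5) : CMHodgeHypothesisAt A := by
  rcases Nat.lt_or_ge A.dim 5 with hlt | hge
  · exact cmHodgeHypothesisAt_of_dim_le_four_of_markman hW4 A (by omega)
  · exact fun _ hCM => hodgeConjectureFor_of_isOfCMType_dim_five_of_markman hW4 A hCM (le_antisymm hA hge)

/-- **The Hodge conjecture for every complex abelian variety of CM type of dimension `≤ 5`, granted Markman's theorem**
(`cmHodgeHypothesisAt_of_dim_le_five_of_markman` unfolded at `AbelianVariety.isSmoothProjective_holds`).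
[cite: MoonenZarhin1999LowDim, Thms. 0.1, 0.2] [cite: Markman2025SurveySecant, §1.1 and Cor. 1.3] -/
theorem hodgeConjectureFor_of_isOfCMType_dim_le_five_of_markman
    (hW4 : Markman2025_weilClasses_algebraic_abelianFourfold) (A : AbelianVariety ℂ) (hCM : IsOfCMType A)
    (hA : A.dim ≤ 5) : HodgeConjectureFor A.dim A.X :=
  cmHodgeHypothesisAt_of_dim_le_five_of_markman hW4 A hA AbelianVariety.isSmoothProjective_holds hCM

end Summit.HodgeConjecture.CorCM.CMWeights

end
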